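/-
Copyright (c) 2026 the pub-hodgecm-mathlib formalisation cell (harness21).  Track B «K2-LIT» prover seat hodgecm-mathlib-K2E3-p21 (g0), 2026-09-03: (S)-WILD, fourth rung —
the FRAMES ∕ GEODESIC-INCLUSION layer of the `U(3)` lattice tree at a RAMIFIED QUADRATIC DATUM of ANY residue characteristic (the `|2| < 1` twins of ★
`UnitaryLatticeTreeGeodesicInclusionOfInvolution` §2 — one-line specialisations of its `_of_involution` heads over Track A's wild transitivities).
-/
import Literature.NumberTheory.Automorphic.UnitaryLatticeTreeGeodesicInclusionOfInvolution  -- ★ (B-p14 ∕ F0P3a lineage): the `_of_involution` heads (`…pair…`, `…geodesic…`, `…of_adj_of_dist…`, (U7) `unitaryLevel_subset_mul…`), ★ `exists_frame_mapGL_stdLattice`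
import Literature.NumberTheory.Automorphic.UnitaryLatticeTreeEulerRelationWild              -- ★ p854681 (LH4-p01 (g17)): `isTree_latticeGraph_three_of_ramified`; brings ★ p854568 htr₀-WILD `exists_unitary_mapGL_stdLattice_eq_of_isSelfDualLattice_of_ramified`, `v_map_sub_self_lt_one_of_even`, ★ p854569 htr₂-WILD `forall_isVertexLattice_two_exists_mapGL_N₁_eq_of_ramified`
import Literature.NumberTheory.Automorphic.UnitaryThreeFourFrameDefs                        -- ★ p854559 (B-p04): the datum token `IsRamifiedQuadraticDatum σ ϖ d t`
import HarnessLib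
/-!
# Frames and geodesic inclusion on the `U(3)` tree at a RAMIFIED QUADRATIC DATUM (tame or WILD): every self-dual vertex is `κ · L_a`, any two vertices lie in one
# apartment translate, the geodesic between them too, and (U7) `U_y ⊆ U_x · U_z` (Bruhat–Tits 1972 (4.4.3), (7.4.18), §10; Tits 1979 §3.3.3; Serre, *Trees* I.2.2; Schneider–Stuhler 1997 I.3.1)

THE SETTING.  `K` a valued field with finite residue field, `σ` an isometric involution (`hσ`, `hvσ`), `ϖ` ANY uniformiser (`hϖ`), `J₀ = antidiag(1,1,1)`, `U = U(σ, J₀)` acting on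
the lattice tree by ★ `latticeGraphIso`; the enumerated standard apartment `A : ℤ → 𝓥` (HYPOTHESIS-STYLE `(A, hA0, hA1)`).  The RAMIFIED letters are those of Track A's datum
`IsRamifiedQuadraticDatum σ ϖ d t`: `heven`, `hd : |ϖ − σϖ| = |ϖ|^d`, `1 ≤ d`, `h2t : |2| = |ϖ|^t` — NO `σϖ = −ϖ`, NO `|2| = 1`, NO norm hypothesis; `[ValuativeRel K] [Valued.v.Compatible]`
where the ★ tree lemma lives.
Cell `pub/hodgecm-mathlib` (D-0151), crux H413 = `stmt-HodgeConjecture-24833`, lane `--supports …`; Track B «K2-LIT» engine E3 (seat K2E3-p21: the (X0′)∕EP-NORM-ONE tower at a wild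
place, census K2/STATUS 22:06:26Z), junction Track A LH4 «(D-RAM) FOUR-FRAME» unit U0.  Topic `NumberTheory/Automorphic`; namespace `Literature.NumberTheory.Automorphic.UnitaryLatticeTree`.
THEOREMS ONLY (no definition, no instance, no notation, no named fact, no `sorry`).

WHAT IS NEW.  Nothing mathematical: ★ §1 of `…GeodesicInclusionOfInvolution` proves everything for ANY isometric involution from three inputs — `hT` (tree), `hfr` (frames of a
self-dual vertex) and `htr₂` (type-two transitivity) — and ★ §2 discharges them at a TAME ramified place (`|2| = 1`: self-dual transitivity ★ `…_of_v_two`).  At a ramified datum of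
ANY residue characteristic the dischargers are Track A's: ★ p854681 `isTree_latticeGraph_three_of_ramified`, ★ p854568 `exists_unitary_mapGL_stdLattice_eq_of_isSelfDualLattice_of_ramified`
(+ ★ `exists_frame_mapGL_stdLattice`, the two-sided Cartan decomposition read on lattices, ANY involution), ★ p854569 `forall_isVertexLattice_two_exists_mapGL_N₁_eq_of_ramified`
(`hres` from ★ `v_map_sub_self_lt_one_of_even`, `2 ≠ 0` from `|2| = |ϖ|^t`).  Token pass `(hσϖ hres h2 hnorm) ↦ (heven hd h1d h2t)`, conclusions VERBATIM, names `…_of_neg ↦ …_of_ramified`.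
CONSUMERS: the wild twins of ★ 41g-H `F0P3cStCharTSCharacterEllipticUniformRamified` ((U7) at the datum) and, through it, 58-W ∕ 61b ∕ TRACE-ONE ∕ TRACE-PAIR of the EP tower.
HONEST LABEL: count-neutral generic lattice-tree layer; re-proves the tame case (`t = 0`), NEW at dyadic places (`t ≥ 1`); h413 OPEN; HC_CM is proved only modulo the 7 printed
citations (2 remaining named inputs hLiu418 = `stmt-HodgeConjecture-24832`, h413 = `stmt-HodgeConjecture-24833`) until rung 0 closes; nothing printed is asserted here.

THIS FILE.  §0 the two dischargers in the `_of_involution` binders' shape (`htr₂'`, frames); §1 `exists_frame_three_of_isSelfDualLattice_of_ramified`,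
`exists_latticeGraphIso_apartmentEnum_pair_of_ramified`, `…_geodesic_of_ramified`, `…_of_adj_of_dist_of_ramified`, (U7) `unitaryLevel_subset_mul_of_adj_of_dist_of_ramified` and
its subtype form — conclusions VERBATIM = ★ §2's.

## References
* [BruhatTits1972] F. Bruhat, J. Tits, *Groupes réductifs sur un corps local I*, Publ. Math. IHÉS 41 (1972), (4.4.3), (7.4.18), §10.
* [Tits1979] J. Tits, *Reductive groups over local fields*, PSPM 33.1 (1979), §2.7 (p. 48), §3.3.3.
* [Serre1980Trees] J.-P. Serre, *Trees* (1980), Ch. I §2.2 Prop. 8, Ch. II §1.1.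
* [SchneiderStuhler1997] P. Schneider, U. Stuhler, *Representation theory and sheaves on the Bruhat–Tits building*, Publ. Math. IHÉS 85 (1997), Ch. I Prop. I.3.1 p. 118.
* [Korman2004] J. Korman, *On the local constancy of characters*, J. Inst. Math. Jussieu (2004), §3.6.
-/

set_option autoImplicit false

noncomputable section

open scoped Valued WithZero Matrix MatrixGroups Pointwise

namespace Literature.NumberTheory.Automorphic.UnitaryLatticeTree

open _root_.SimpleGraph Literature.NumberTheory.Automorphic Literature.NumberTheory.Automorphic.HermitianLattice
open Literature.NumberTheory.Automorphic.UnitaryGroup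
open Literature.NumberTheory.Automorphic.CartanUnique (uniformizer_ne_zero)
open Literature.NumberTheory.Automorphic.UnitaryThreeFourFrame

variable {K : Type*} [Field K] [Valued K ℤᵐ⁰] {σ : K →+* K} {ϖ : K}

/-! ## §0 The dischargers in the `_of_involution` binders' shape -/

/-- **TYPE-TWO TRANSITIVITY AT A RAMIFIED DATUM, in the `htr₂` binder's letters** (`hσ hvσ hϖ heven hd h1d h2t`): ★ p854569
`forall_isVertexLattice_two_exists_mapGL_N₁_eq_of_ramified` with its `hres` from ★ `v_map_sub_self_lt_one_of_even` and its `2 ≠ 0` from `|2| = |ϖ|^t`. [cite: BruhatTits1972, §10] -/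
theorem forall_isVertexLattice_two_exists_mapGL_N₁_eq_of_ramified' [Finite 𝓀[K]] (hσ : ∀ x, σ (σ x) = x) (hvσ : ∀ a, Valued.v (σ a) = Valued.v a)
    (hϖ : Valued.v ϖ = WithZero.exp (-1 : ℤ)) (heven : ∀ x : K, σ x = x → x ≠ 0 → ∃ n : ℤ, Valued.v x = WithZero.exp (2 * n)) {d t : ℕ}
    (hd : Valued.v (ϖ - σ ϖ) = Valued.v ϖ ^ d) (h1d : 1 ≤ d) (h2t : Valued.v (2 : K) = Valued.v ϖ ^ t) :
    ∀ M : Submodule 𝒪[K] (Fin 3 → K), IsVertexLattice σ ϖ ((StdForm.antidiagonal 3).over K) 2 M →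
      ∃ u : unitaryGroupOfForm σ ((StdForm.antidiagonal 3).over K), M = mapGL (u : GL (Fin 3) K) (latt (Matrix.diagonal ![(1 : K), 1, ϖ])) := by
  have h20 : (2 : K) ≠ 0 := fun h => by
    rw [h, map_zero] at h2t
    exact pow_ne_zero t ((Valuation.ne_zero_iff Valued.v).2 (uniformizer_ne_zero hϖ)) h2t.symm
  exact forall_isVertexLattice_two_exists_mapGL_N₁_eq_of_ramified hσ hvσ hϖ (fun x hx => v_map_sub_self_lt_one_of_even hσ hϖ heven hd h1d hx) heven h20

/-! ## §1 Frames, apartment pairs, geodesics and (U7) at a ramified quadratic datum -/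

section Sheet

variable [ValuativeRel K] [(Valued.v : Valuation K ℤᵐ⁰).Compatible]

/-- **FRAMES OF A SELF-DUAL VERTEX AT A RAMIFIED QUADRATIC DATUM (tame or wild)**: every self-dual `M` is `κ · L_a` with `κ ∈ K₀`, `a : ℤ` (self-dual transitivity ★ p854568
`exists_unitary_mapGL_stdLattice_eq_of_isSelfDualLattice_of_ramified` + the two-sided Cartan decomposition of ANY isometric involution read on lattices ★ `exists_frame_mapGL_stdLattice`)
— the twin of ★ `exists_frame_three_of_isSelfDualLattice_of_neg` (`|2| = 1`); conclusion VERBATIM. [cite: BruhatTits1972, (4.4.3), §10] [cite: Tits1979, §3.3.3] -/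
theorem exists_frame_three_of_isSelfDualLattice_of_ramified (hσ : ∀ x, σ (σ x) = x) (hvσ : ∀ a, Valued.v (σ a) = Valued.v a) (hϖ : Valued.v ϖ = WithZero.exp (-1 : ℤ))
    (heven : ∀ x : K, σ x = x → x ≠ 0 → ∃ n : ℤ, Valued.v x = WithZero.exp (2 * n)) {d t : ℕ}
    (hd : Valued.v (ϖ - σ ϖ) = Valued.v ϖ ^ d) (h1d : 1 ≤ d) (h2t : Valued.v (2 : K) = Valued.v ϖ ^ t) [Finite 𝓀[K]]
    (M : Submodule 𝒪[K] (Fin 3 → K)) (hM : IsSelfDualLattice σ ϖ ((StdForm.antidiagonal 3).over K) M) :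
    ∃ k : unitaryGroupOfForm σ ((StdForm.antidiagonal 3).over K), k ∈ unitaryInt σ ((StdForm.antidiagonal 3).over K) ∧
      ∃ a : ℤ, M = mapGL (k : GL (Fin 3) K) (latt (Matrix.diagonal ![ϖ ^ a, 1, ϖ ^ (-a)])) := by
  obtain ⟨u, hu⟩ := exists_unitary_mapGL_stdLattice_eq_of_isSelfDualLattice_of_ramified hσ hvσ hϖ heven hd h1d h2t M hM
  obtain ⟨κ, hκ, a, ha⟩ := exists_frame_mapGL_stdLattice hσ hvσ hϖ u
  exact ⟨κ, hκ, a, by rw [hu, ha]⟩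


/-- **ANY TWO VERTICES OF THE RAMIFIED (tame or wild) `U(3)` TREE LIE IN ONE TRANSLATE OF THE STANDARD APARTMENT**: `x = u·A i`, `z = u·A k`, `i ≤ k` — ★ row 39γ's
`exists_latticeGraphIso_apartmentEnum_pair` at the ramified datum letters `(heven, hd, h1d, h2t)`. [cite: BruhatTits1972, (7.4.18), §10] [cite: Tits1979, §2.4] [cite: Serre1980Trees, I.2.2, II.1.1] -/
theorem exists_latticeGraphIso_apartmentEnum_pair_of_ramified (hσ : ∀ x, σ (σ x) = x) (hvσ : ∀ a, Valued.v (σ a) = Valued.v a) (hϖ : Valued.v ϖ = WithZero.exp (-1 : ℤ))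
    (heven : ∀ x : K, σ x = x → x ≠ 0 → ∃ n : ℤ, Valued.v x = WithZero.exp (2 * n)) {d t : ℕ}
    (hd : Valued.v (ϖ - σ ϖ) = Valued.v ϖ ^ d) (h1d : 1 ≤ d) (h2t : Valued.v (2 : K) = Valued.v ϖ ^ t) [Finite 𝓀[K]]
    (A : ℤ → {M : Submodule 𝒪[K] (Fin 3 → K) // IsVertex σ ϖ ((StdForm.antidiagonal 3).over K) M})
    (hA0 : ∀ a : ℤ, (A (2 * a)).1 = latt (Matrix.diagonal ![ϖ ^ a, (1 : K), ϖ ^ (-a)]))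
    (hA1 : ∀ a : ℤ, (A (2 * a + 1)).1 = latt (Matrix.diagonal ![ϖ ^ (a + 1), (1 : K), ϖ ^ (-a)]))
    (x z : {M : Submodule 𝒪[K] (Fin 3 → K) // IsVertex σ ϖ ((StdForm.antidiagonal 3).over K) M}) :
    ∃ u : unitaryGroupOfForm σ ((StdForm.antidiagonal 3).over K), ∃ i k : ℤ, i ≤ k ∧
      x = latticeGraphIso σ ϖ ((StdForm.antidiagonal 3).over K) u (A i) ∧ z = latticeGraphIso σ ϖ ((StdForm.antidiagonal 3).over K) u (A k) :=
  exists_latticeGraphIso_apartmentEnum_pair_of_involution hσ hvσ hϖ A hA0 hA1 (isTree_latticeGraph_three_of_ramified hσ hvσ hϖ heven hd h1d h2t)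
    (exists_frame_three_of_isSelfDualLattice_of_ramified hσ hvσ hϖ heven hd h1d h2t) (forall_isVertexLattice_two_exists_mapGL_N₁_eq_of_ramified' hσ hvσ hϖ heven hd h1d h2t) x z

/-- **THE GEODESIC BETWEEN TWO VERTICES OF THE RAMIFIED (tame or wild) TREE LIES IN ONE APARTMENT TRANSLATE** (`dist x z = k − i`; every `w ∈ [x, z]` is `u·A j`, `i ≤ j ≤ k`).
[cite: BruhatTits1972, (7.4.18), §10] [cite: Tits1979, §2.4] [cite: Serre1980Trees, I.2.2 Prop. 8] -/
theorem exists_latticeGraphIso_apartmentEnum_geodesic_of_ramified (hσ : ∀ x, σ (σ x) = x) (hvσ : ∀ a, Valued.v (σ a) = Valued.v a) (hϖ : Valued.v ϖ = WithZero.exp (-1 : ℤ))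
    (heven : ∀ x : K, σ x = x → x ≠ 0 → ∃ n : ℤ, Valued.v x = WithZero.exp (2 * n)) {d t : ℕ}
    (hd : Valued.v (ϖ - σ ϖ) = Valued.v ϖ ^ d) (h1d : 1 ≤ d) (h2t : Valued.v (2 : K) = Valued.v ϖ ^ t) [Finite 𝓀[K]]
    (A : ℤ → {M : Submodule 𝒪[K] (Fin 3 → K) // IsVertex σ ϖ ((StdForm.antidiagonal 3).over K) M})
    (hA0 : ∀ a : ℤ, (A (2 * a)).1 = latt (Matrix.diagonal ![ϖ ^ a, (1 : K), ϖ ^ (-a)]))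
    (hA1 : ∀ a : ℤ, (A (2 * a + 1)).1 = latt (Matrix.diagonal ![ϖ ^ (a + 1), (1 : K), ϖ ^ (-a)]))
    (x z : {M : Submodule 𝒪[K] (Fin 3 → K) // IsVertex σ ϖ ((StdForm.antidiagonal 3).over K) M}) :
    ∃ u : unitaryGroupOfForm σ ((StdForm.antidiagonal 3).over K), ∃ i k : ℤ, i ≤ k ∧
      x = latticeGraphIso σ ϖ ((StdForm.antidiagonal 3).over K) u (A i) ∧ z = latticeGraphIso σ ϖ ((StdForm.antidiagonal 3).over K) u (A k) ∧
      ((latticeGraph σ ϖ ((StdForm.antidiagonal 3).over K)).dist x z : ℤ) = k - i ∧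
      ∀ w, (latticeGraph σ ϖ ((StdForm.antidiagonal 3).over K)).dist x w + (latticeGraph σ ϖ ((StdForm.antidiagonal 3).over K)).dist w z =
          (latticeGraph σ ϖ ((StdForm.antidiagonal 3).over K)).dist x z →
        ∃ j : ℤ, i ≤ j ∧ j ≤ k ∧ w = latticeGraphIso σ ϖ ((StdForm.antidiagonal 3).over K) u (A j) :=
  exists_latticeGraphIso_apartmentEnum_geodesic_of_involution hσ hvσ hϖ A hA0 hA1 (isTree_latticeGraph_three_of_ramified hσ hvσ hϖ heven hd h1d h2t)
    (exists_frame_three_of_isSelfDualLattice_of_ramified hσ hvσ hϖ heven hd h1d h2t) (forall_isVertexLattice_two_exists_mapGL_N₁_eq_of_ramified' hσ hvσ hϖ heven hd h1d h2t) x z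

/-- **THE (U7) ANTECEDENT AT A RAMIFIED QUADRATIC DATUM (tame or wild)**: `x ~ y`, `dist y z + 1 = dist x z` ⇒ `(x, y, z) = u·(A i, A (i+1), A k)` with `i + 1 ≤ k`.
[cite: SchneiderStuhler1997, Prop. I.3.1 p. 118] [cite: BruhatTits1972, (7.4.18), §10] [cite: Tits1979, §2.4] -/
theorem exists_latticeGraphIso_apartmentEnum_of_adj_of_dist_of_ramified (hσ : ∀ x, σ (σ x) = x) (hvσ : ∀ a, Valued.v (σ a) = Valued.v a) (hϖ : Valued.v ϖ = WithZero.exp (-1 : ℤ))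
    (heven : ∀ x : K, σ x = x → x ≠ 0 → ∃ n : ℤ, Valued.v x = WithZero.exp (2 * n)) {d t : ℕ}
    (hd : Valued.v (ϖ - σ ϖ) = Valued.v ϖ ^ d) (h1d : 1 ≤ d) (h2t : Valued.v (2 : K) = Valued.v ϖ ^ t) [Finite 𝓀[K]]
    (A : ℤ → {M : Submodule 𝒪[K] (Fin 3 → K) // IsVertex σ ϖ ((StdForm.antidiagonal 3).over K) M})
    (hA0 : ∀ a : ℤ, (A (2 * a)).1 = latt (Matrix.diagonal ![ϖ ^ a, (1 : K), ϖ ^ (-a)]))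
    (hA1 : ∀ a : ℤ, (A (2 * a + 1)).1 = latt (Matrix.diagonal ![ϖ ^ (a + 1), (1 : K), ϖ ^ (-a)]))
    {x y z : {M : Submodule 𝒪[K] (Fin 3 → K) // IsVertex σ ϖ ((StdForm.antidiagonal 3).over K) M}}
    (hxy : (latticeGraph σ ϖ ((StdForm.antidiagonal 3).over K)).Adj x y)
    (hyz : (latticeGraph σ ϖ ((StdForm.antidiagonal 3).over K)).dist y z + 1 = (latticeGraph σ ϖ ((StdForm.antidiagonal 3).over K)).dist x z) :
    ∃ u : unitaryGroupOfForm σ ((StdForm.antidiagonal 3).over K), ∃ i k : ℤ, i + 1 ≤ k ∧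
      x = latticeGraphIso σ ϖ ((StdForm.antidiagonal 3).over K) u (A i) ∧ y = latticeGraphIso σ ϖ ((StdForm.antidiagonal 3).over K) u (A (i + 1)) ∧
      z = latticeGraphIso σ ϖ ((StdForm.antidiagonal 3).over K) u (A k) :=
  exists_latticeGraphIso_apartmentEnum_of_adj_of_dist_of_involution hσ hvσ hϖ A hA0 hA1 (isTree_latticeGraph_three_of_ramified hσ hvσ hϖ heven hd h1d h2t)
    (exists_frame_three_of_isSelfDualLattice_of_ramified hσ hvσ hϖ heven hd h1d h2t) (forall_isVertexLattice_two_exists_mapGL_N₁_eq_of_ramified' hσ hvσ hϖ heven hd h1d h2t) hxy hyz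

/-- **(U7) GEODESIC INCLUSION AT A RAMIFIED QUADRATIC DATUM (tame or wild)** (any ramified quadratic datum): `x ~ y`, `dist y z + 1 = dist x z` ⇒ `U_y ⊆ U_x · U_z` — ★ row 41-U7's head with the
datum replaced by the ramified letters. [cite: SchneiderStuhler1997, Ch. I Prop. I.3.1 p. 118] [cite: Korman2004, §3.6] [cite: BruhatTits1972, (7.4.18)] [cite: Tits1979, §2.4] -/
theorem unitaryLevel_subset_mul_of_adj_of_dist_of_ramified (hσ : ∀ x, σ (σ x) = x) (hvσ : ∀ a, Valued.v (σ a) = Valued.v a) (hϖ : Valued.v ϖ = WithZero.exp (-1 : ℤ))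
    (heven : ∀ x : K, σ x = x → x ≠ 0 → ∃ n : ℤ, Valued.v x = WithZero.exp (2 * n)) {d t : ℕ}
    (hd : Valued.v (ϖ - σ ϖ) = Valued.v ϖ ^ d) (h1d : 1 ≤ d) (h2t : Valued.v (2 : K) = Valued.v ϖ ^ t) [Finite 𝓀[K]] {c : K} (hc0 : c ≠ 0) (hc1 : Valued.v c < 1)
    (U : {M : Submodule 𝒪[K] (Fin 3 → K) // IsVertex σ ϖ ((StdForm.antidiagonal 3).over K) M} → Subgroup (GL (Fin 3) K))
    (hU : ∀ (x : {M : Submodule 𝒪[K] (Fin 3 → K) // IsVertex σ ϖ ((StdForm.antidiagonal 3).over K) M}) (g : GL (Fin 3) K),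
      g ∈ U x ↔ g ∈ unitaryGroupOfForm σ ((StdForm.antidiagonal 3).over K) ∧ mapGL g x.1 = x.1 ∧
        x.1.map ((Matrix.toLin' ((g : Matrix (Fin 3) (Fin 3) K) - 1)).restrictScalars 𝒪[K]) ≤ scaleLattice c x.1)
    {x y z : {M : Submodule 𝒪[K] (Fin 3 → K) // IsVertex σ ϖ ((StdForm.antidiagonal 3).over K) M}}
    (hxy : (latticeGraph σ ϖ ((StdForm.antidiagonal 3).over K)).Adj x y)
    (hyz : (latticeGraph σ ϖ ((StdForm.antidiagonal 3).over K)).dist y z + 1 = (latticeGraph σ ϖ ((StdForm.antidiagonal 3).over K)).dist x z) :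
    (U y : Set (GL (Fin 3) K)) ⊆ (U x : Set (GL (Fin 3) K)) * (U z : Set (GL (Fin 3) K)) :=
  unitaryLevel_subset_mul_of_adj_of_dist_of_involution hσ hvσ hϖ (isTree_latticeGraph_three_of_ramified hσ hvσ hϖ heven hd h1d h2t)
    (exists_frame_three_of_isSelfDualLattice_of_ramified hσ hvσ hϖ heven hd h1d h2t) (forall_isVertexLattice_two_exists_mapGL_N₁_eq_of_ramified' hσ hvσ hϖ heven hd h1d h2t) hc0 hc1 U hU hxy hyz

/-- **(U7) GEODESIC INCLUSION AT A RAMIFIED QUADRATIC DATUM (tame or wild) — SUBTYPE FORM** (row 34's `hU7` shape, `Γ = ↥U(σ, J)`, `J = Φ₃` as `hJ`).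
[cite: SchneiderStuhler1997, Ch. I Prop. I.3.1 p. 118] [cite: Korman2004, §3.6] [cite: BruhatTits1972, (7.4.18)] [cite: Tits1979, §2.4] -/
theorem unitaryLevel_subset_mul_of_adj_of_dist_subtype_of_ramified (hσ : ∀ x, σ (σ x) = x) (hvσ : ∀ a, Valued.v (σ a) = Valued.v a) (hϖ : Valued.v ϖ = WithZero.exp (-1 : ℤ))
    (heven : ∀ x : K, σ x = x → x ≠ 0 → ∃ n : ℤ, Valued.v x = WithZero.exp (2 * n)) {d t : ℕ}
    (hd : Valued.v (ϖ - σ ϖ) = Valued.v ϖ ^ d) (h1d : 1 ≤ d) (h2t : Valued.v (2 : K) = Valued.v ϖ ^ t) [Finite 𝓀[K]] {c : K} (hc0 : c ≠ 0) (hc1 : Valued.v c < 1)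
    {J : Matrix (Fin 3) (Fin 3) K} (hJ : J = (StdForm.antidiagonal 3).over K)
    (U : {M : Submodule 𝒪[K] (Fin 3 → K) // IsVertex σ ϖ J M} → Subgroup ↥(unitaryGroupOfForm σ J))
    (hU : ∀ (x : {M : Submodule 𝒪[K] (Fin 3 → K) // IsVertex σ ϖ J M}) (γ : ↥(unitaryGroupOfForm σ J)),
      γ ∈ U x ↔ mapGL (γ : GL (Fin 3) K) x.1 = x.1 ∧ x.1.map ((Matrix.toLin' (((γ : GL (Fin 3) K) : Matrix (Fin 3) (Fin 3) K) - 1)).restrictScalars 𝒪[K]) ≤ scaleLattice c x.1)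
    {x y z : {M : Submodule 𝒪[K] (Fin 3 → K) // IsVertex σ ϖ J M}}
    (hxy : (latticeGraph σ ϖ J).Adj x y) (hyz : (latticeGraph σ ϖ J).dist y z + 1 = (latticeGraph σ ϖ J).dist x z) :
    (U y : Set ↥(unitaryGroupOfForm σ J)) ⊆ (U x : Set ↥(unitaryGroupOfForm σ J)) * (U z : Set ↥(unitaryGroupOfForm σ J)) := by
  subst hJ
  exact unitaryLevel_subset_mul_of_adj_of_dist_subtype_of_involution hσ hvσ hϖ (isTree_latticeGraph_three_of_ramified hσ hvσ hϖ heven hd h1d h2t)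
    (exists_frame_three_of_isSelfDualLattice_of_ramified hσ hvσ hϖ heven hd h1d h2t) (forall_isVertexLattice_two_exists_mapGL_N₁_eq_of_ramified' hσ hvσ hϖ heven hd h1d h2t) hc0 hc1 rfl U hU hxy hyz


end Sheet

end Literature.NumberTheory.Automorphic.UnitaryLatticeTree

end
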